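import Mathlib
import Summits.ResolutionOfSingularities.ResolutionOfSingularities.Theorems.SyzygyFlatteningDefs
import Summits.ResolutionOfSingularities.ResolutionOfSingularities.Theorems.SyzygyFlatteningHigherRankTerminationBaseChangeIsLocalization
import HarnessLib

/-!
# Syzygy-flattening tower: the new ground field `k(X)` consists of `w`-units

Stub `stub_groundField_units` of the crux `HigherRankTermination` (line `birth`, base-change line
`(k, K) ↦ (k(X), K(X))`, wave 2).

Situation: `v` is a real-valued valuation of the field `K` with valuation ring `O ⊇ k`; `ζ ∈ O`
has residue transcendental over `k` (hypothesis: `v (G ζ) = 1` for every non-zero `G ∈ k[X]`);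
`w` is a valuation of `K(X) = RatFunc K` extending `v` with `w (X - ζ) < 1` and the domination
property `v (f ζ) ≤ w f` for `f ∈ K[X]`.  The abstract field `k'` is mapped isomorphically onto
`k(X) = IntermediateField.adjoin k {X} ⊆ K(X)` (the range hypothesis).

Claim: every non-zero `g ∈ k'` is a `w`-unit, `w g = 1`.

Proof.  By the range hypothesis `g = r(X) / s(X)` with `r, s ∈ k[X]`, both non-zero.  For a
non-zero `G ∈ k[X]`:
* `w (G(X)) ≤ 1`: the coefficients of `G` lie in `k ⊆ O`, so have `w = v ≤ 1`, and
  `w X ≤ max (w (X - ζ)) (w ζ) ≤ 1`;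
* `w (G(X)) ≥ v (G ζ) = 1` by domination and residual transcendence of `ζ`.
Hence `w (r(X)) = w (s(X)) = 1` and `w g = 1 / 1 = 1`.

Sources: folklore (residually transcendental extensions of a valuation to `K(X)` are trivial on
the constant subfield `k(X)` when the centre has transcendental residue; cf. Kuhlmann 2010, §2).
-/

noncomputable section

-- single-problem summit: the doubled namespace component is forced
set_option linter.dupNamespace false

open scoped NNReal

namespace Summit.ResolutionOfSingularities.ResolutionOfSingularities.Theorems.SyzygyFlattening

open Polynomial

/-- A valuation is `≤ 1` on the image of a polynomial under a ring map sending its coefficients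
and the variable to elements of valuation `≤ 1`. [folklore] -/
theorem groundFieldUnits_map_polynomial_le_one {R L : Type*} [CommRing R] [CommRing L]
    (φ : R[X] →+* L) (w : Valuation L ℝ≥0) (f : R[X])
    (hcoeff : ∀ i, w (φ (C (f.coeff i))) ≤ 1) (hX : w (φ X) ≤ 1) : w (φ f) ≤ 1 := by
  rw [f.as_sum_support_C_mul_X_pow, map_sum]
  refine w.map_sum_le fun i _ => ?_
  simp only [map_mul, map_pow]
  exact mul_le_one' (hcoeff i) (pow_le_one' hX i)

/-- In the situation of `stub_groundField_units`: a non-zero `k`-polynomial `G`, read in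
`K(X)` as `G(X)`, is a `w`-unit.  Upper bound: coefficients in `k ⊆ O` and `w X ≤ 1`
(`X = (X - ζ) + ζ`); lower bound: `w (G(X)) ≥ v (G ζ) = 1` (domination and residual
transcendence of `ζ`). [folklore] -/
theorem groundFieldUnits_aeval_X {k K : Type*} [Field k] [Field K] [Algebra k K]
    (O : ValuationSubring K) (hk : ∀ c : k, algebraMap k K c ∈ O)
    (v : Valuation K ℝ≥0) (hv : ∀ x : K, v x ≤ 1 ↔ x ∈ O) (ζ : K) (hζ : ζ ∈ O)
    (htr : ∀ G : Polynomial k, G ≠ 0 → v (Polynomial.aeval ζ G) = 1)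
    (w : Valuation (RatFunc K) ℝ≥0) (hwv : ∀ a : K, w (algebraMap K (RatFunc K) a) = v a)
    (hwX : w (RatFunc.X - algebraMap K (RatFunc K) ζ) < 1)
    (hdom : ∀ f : Polynomial K, v (f.eval ζ) ≤ w (algebraMap (Polynomial K) (RatFunc K) f))
    {G : Polynomial k} (hG : G ≠ 0) :
    w (Polynomial.aeval (RatFunc.X : RatFunc K) G) = 1 := by
  rw [← Polynomial.aeval_map_algebraMap K, RatFunc.aeval_X_left_eq_algebraMap]
  refine le_antisymm ?_ ?_
  · refine groundFieldUnits_map_polynomial_le_one _ w _ (fun i => ?_) ?_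
    · rw [Polynomial.coeff_map, RatFunc.algebraMap_C, ← RatFunc.algebraMap_eq_C, hwv]
      exact (hv _).2 (hk _)
    · rw [RatFunc.algebraMap_X]
      calc w (RatFunc.X : RatFunc K)
          = w ((RatFunc.X - algebraMap K (RatFunc K) ζ) + algebraMap K (RatFunc K) ζ) := by
            rw [sub_add_cancel]
        _ ≤ 1 := w.map_add_le hwX.le (by rw [hwv]; exact (hv ζ).2 hζ)
  · calc (1 : ℝ≥0) = v (Polynomial.aeval ζ G) := (htr G hG).symm
      _ = v ((G.map (algebraMap k K)).eval ζ) := by rw [Polynomial.eval_map_algebraMap]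
      _ ≤ w (algebraMap (Polynomial K) (RatFunc K) (G.map (algebraMap k K))) := hdom _

/-- **STUB `stub_groundField_units`.** In the base-change step `(k, K) ↦ (k(X), K(X))` of the
syzygy-flattening tower: if `v` is a real-valued valuation of `K` with ring `O ⊇ k`, `ζ ∈ O`
has residue transcendental over `k`, and `w` extends `v` to `K(X)` with `w (X - ζ) < 1` and
`v (f ζ) ≤ w f` for `f ∈ K[X]`, then every non-zero element of the new ground field
`k' ≅ k(X) ⊆ K(X)` is a `w`-unit: `w g = 1`.  (Write `g = r(X) / s(X)` with `r, s ∈ k[X]`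
non-zero and use `w (r(X)) = w (s(X)) = 1`.) [folklore] -/
theorem stub_groundField_units : ∀ (k K : Type) [Field k] [Field K] [Algebra k K]
    (O : ValuationSubring K), (∀ c : k, algebraMap k K c ∈ O) →
    ∀ (v : Valuation K ℝ≥0), (∀ x : K, v x ≤ 1 ↔ x ∈ O) →
    ∀ (ζ : K), ζ ∈ O → (∀ G : Polynomial k, G ≠ 0 → v (Polynomial.aeval ζ G) = 1) →
    ∀ (w : Valuation (RatFunc K) ℝ≥0), (∀ a : K, w (algebraMap K (RatFunc K) a) = v a) →
      w (RatFunc.X - algebraMap K (RatFunc K) ζ) < 1 →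
      (∀ f : Polynomial K, v (f.eval ζ) ≤ w (algebraMap (Polynomial K) (RatFunc K) f)) →
    ∀ (k' : Type) [Field k'] [Algebra k k'] [Algebra k' (RatFunc K)] [IsScalarTower k k' (RatFunc K)],
      Set.range (algebraMap k' (RatFunc K)) =
        ((IntermediateField.adjoin k {(RatFunc.X : RatFunc K)} : IntermediateField k (RatFunc K)) :
          Set (RatFunc K)) →
      ∀ g : k', g ≠ 0 → w (algebraMap k' (RatFunc K) g) = 1 := by
  intro k K _ _ _ O hk v hv ζ hζ htr w hwv hwX hdom k' _ _ _ _ hrange g hg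
  obtain ⟨r, s, hrs⟩ :=
    (IntermediateField.mem_adjoin_simple_iff k (α := (RatFunc.X : RatFunc K))
      (algebraMap k' (RatFunc K) g)).mp (by
        change algebraMap k' (RatFunc K) g ∈
          ((IntermediateField.adjoin k {(RatFunc.X : RatFunc K)} :
            IntermediateField k (RatFunc K)) : Set (RatFunc K))
        rw [← hrange]
        exact ⟨g, rfl⟩)
  have hg' : algebraMap k' (RatFunc K) g ≠ 0 := (map_ne_zero (algebraMap k' (RatFunc K))).mpr hg
  have hr : r ≠ 0 := by
    rintro rfl
    exact hg' (by rw [hrs, map_zero, zero_div])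
  have hs : s ≠ 0 := by
    rintro rfl
    exact hg' (by rw [hrs, map_zero, div_zero])
  rw [hrs, map_div₀, groundFieldUnits_aeval_X O hk v hv ζ hζ htr w hwv hwX hdom hr,
    groundFieldUnits_aeval_X O hk v hv ζ hζ htr w hwv hwX hdom hs, div_one]

end Summit.ResolutionOfSingularities.ResolutionOfSingularities.Theorems.SyzygyFlattening

end
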